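import Literature.AlgebraicGeometry.Resolution.InseparableLocalUniformizationCurvesStepOne
import Literature.AlgebraicGeometry.Resolution.RankOneDensity
import Mathlib.FieldTheory.IsAlgClosed.AlgebraicClosure
import HarnessLib

/-!
# The chart datum of the algebraic proof of Temkin's Thm. 3.3.1 (smooth-fibre case) — set-up

Topic: `Literature/AlgebraicGeometry/Resolution` (valued function fields). M. Temkin, *Inseparable
local uniformization*, J. Algebra 373 (2013) = arXiv:0804.1554v3, Thm. 3.3.1 with `n = 1` and
`k`-smooth generic fibres (tree: the named fact `Temkin2013RelativeCurveSmoothFibre`,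
`InseparableLocalUniformizationCurvesStepOne.lean`). This file only PACKAGES the data on which
the algebraic construction of the common smooth roof operates (the series `DChart*.lean`,
`EChart.lean`, `RoofInField.lean`), in the style of `DecompChart` (`DecompletionSetup.lean`) for
Lemma 3.3.2. Everything sits inside ONE algebraically closed valued field `(Ω, V)` over the tower
`k → K → L₁ → Ω` (`L₁ = lK₁` after the purely inseparable reduction of Step 1, so that `l = k`
here), `V` inducing `L₁°, K°, k°`:

* the affine normalized `k°`-model `A` of `K°` (Temkin §3.3) — field `A`, `hA`;
* the CONSTANTS: a `k°`-integral, `k`-separable `y₀ ∈ O_V` lying in the henselization `L` of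
  `(L₁, L₁°)` inside `Ω` (the valuation-theoretic input "`m ⊂ L₁^h`" of the printed Step 2), an
  approximant `y ∈ L₁°` of it to Newton precision, `m = k(y₀)`, and a finite Galois `M ⊇ m` inside `m̃` with `M ∩ L ⊆ m` (the Galois closure, `m`
  enlarged to `M ∩ L`);
* the DISC: the henselian generator `x ∈ L₁°` and an `m`-rational disc `|X − a| ≤ |c|` through
  the point (Step 2: "`W_{i,l}` is a closed unit `m̄ᵢ`-disc");
* the `K`-RATIONAL CUT-OUT of that disc (Step 3: the refinement `V = Spec(B)` of the `K`-model
  by `K`-rational functions; it must be `K`-rational because the conclusion speaks of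
  `Nr_{L₁}(A′)` for a `K`-model `A′`): one `g_K ∈ K°` (a generator of the fine model) together
  with a "sheet cutter" `b` — a `V`-unit with a fraction form over `m°` through `x` or an element
  of `Z`, which lies in, and whose being a unit forces `|x − a| ≤ |c|` at, every valuation ring
  over `x, g_K, Z` inducing `V` on `M` (fields `gK, b, hvb, hbfracZ, hbmemZ, hbcutZ`). In the
  absolute case `x ∈ K` these come from the conjugate-discs analysis (`DiscCutoutPackage.lean`:
  `g_K = Q(x)^e/d`, `b = ∏_{far}(x − aᵢ)/(a − aᵢ)`); in general from the same analysis for a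
  henselian generator `x_K ∈ K° ∩ Z` of `K` over its own deep disc, the `x̂₁`-component of whose
  preimage is the disc of the datum (Temkin, proof of Thm. 3.2.6, Step 1: "the preimage of a
  disc is a disjoint union of discs"); their regularity on the `m°`-side is part of the E-data
  (`DChartRoof.lean`);
* finitely many further elements `Z ⊆ L₁°` to be made regular on the model.

* `RelCurveChart` — the datum (a structure; no axioms beyond its fields) — DEFINITION;
* `RelCurveChart.kΩ/KΩ/L₁Ω/L/R₀/xΩ/x'` and the first bookkeeping lemmas — PROVED.

No named facts are introduced.

## Sources

* M. Temkin, arXiv:0804.1554v3, Thm. 3.3.1 and its proof, Steps 1–4 (pp. 44–45); Thm. 3.2.6,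
  Step 1 (p. 43) ("the preimage of any disc … is a disjoint union of discs").
-/

noncomputable section

open IsLocalRing

namespace Literature.AlgebraicGeometry.Resolution

universe u

/-- **The chart datum for Thm. 3.3.1 (smooth-fibre case, `n = 1`).** See the module docstring
for the meaning of the fields. [cite: Temkin2013, Thm. 3.3.1 (proof, Steps 1–4)] -/
structure RelCurveChart (k K L₁ Ω : Type u) [Field k] [Field K] [Field L₁] [Field Ω]
    [Algebra k K] [Algebra K L₁] [Algebra k L₁] [IsScalarTower k K L₁]
    [Algebra L₁ Ω] [Algebra K Ω] [Algebra k Ω] [IsScalarTower K L₁ Ω] [IsScalarTower k L₁ Ω]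
    [IsAlgClosed Ω] [FiniteDimensional K L₁] where
  /-- `k°`. -/
  Ok : ValuationSubring k
  /-- `K°`. -/
  O : ValuationSubring K
  /-- `L₁°`. -/
  O₁ : ValuationSubring L₁
  /-- The ambient valuation ring, inducing `L₁°`. -/
  V : ValuationSubring Ω
  hV : V.comap (algebraMap L₁ Ω) = O₁
  hO₁ : O₁.comap (algebraMap K L₁) = O
  hO : O.comap (algebraMap k K) = Ok
  /-- Height one everywhere. -/
  hdimk : ringKrullDim Ok = 1
  hdimK : ringKrullDim O = 1
  hdim₁ : ringKrullDim O₁ = 1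
  /-- The affine normalized model of `K°` over `k°`. -/
  A : Subring K
  hA : IsAffineNormalizedModel O (Ok.toSubring.map (algebraMap k K)) A
  /-- The primitive constant `y₀`: `k°`-integral (`P` its minimal polynomial, coefficients in
  `k°`), separable over `k`, in `O_V`, and in the henselization of `L₁`. -/
  y₀ : Ω
  hy₀V : y₀ ∈ V
  P : Polynomial k
  hP : P = minpoly k y₀
  hPcoef : ∀ i, P.coeff i ∈ Ok
  hy₀int : IsIntegral k y₀
  hy₀sep : IsSeparable k y₀
  hy₀h : y₀ ∈ henselization V (algebraMap L₁ Ω).fieldRange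
  /-- The APPROXIMANT `y ∈ L₁°` of `y₀` to the Newton precision `|y₀ − y| < |P′(y₀)|²` (it exists
  by density of `L₁` in its henselization, see `RelCurveChart.exists_y` in `DChartModel.lean`; it
  is a field because the deep centre below must be chosen AFTER it). -/
  ya : L₁
  hya : ya ∈ O₁
  hya_lt : V.valuation (y₀ - algebraMap L₁ Ω ya) <
    V.valuation (Polynomial.aeval y₀ (Polynomial.derivative P)) ^ 2
  /-- The constant field `m = k(y₀)` as a subfield of `Ω`. -/
  m : Subfield Ω
  hm : m = (IntermediateField.adjoin k ({y₀} : Set Ω)).toSubfield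
  /-- The finite Galois `M ⊇ m` inside `m̃`, with `M ∩ L₁^h ⊆ m`. -/
  M : IntermediateField m (algebraicClosure m Ω)
  finM : FiniteDimensional m M
  galM : IsGalois m M
  hML : ∀ z : M, ((z : algebraicClosure m Ω) : Ω) ∈ henselization V (algebraMap L₁ Ω).fieldRange →
    ((z : algebraicClosure m Ω) : Ω) ∈ m
  /-- `(L₁, V)` has rank one (density of `L₁` in its henselization). -/
  hrank : IsRankOneValued V (algebraMap L₁ Ω).fieldRange
  /-- The henselian generator (transcendental over `k`) and the `m`-rational disc through the
  point. -/
  x : L₁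
  hx : x ∈ O₁
  hxtr : Transcendental k (algebraMap L₁ Ω x)
  a : Ω
  c : Ω
  ham : a ∈ m
  hcm : c ∈ m
  haV : a ∈ V
  hcV : c ∈ V
  hc0 : c ≠ 0
  hΔ : V.valuation (algebraMap L₁ Ω x - a) ≤ V.valuation c
  /-- All `k`-conjugates of `a` lie in `M`. -/
  hconjM : ∀ α : Ω, Polynomial.aeval α (minpoly k a) = 0 →
    ∃ z : M, ((z : algebraicClosure m Ω) : Ω) = α
  /-- The `K`-rational cut-out of the disc and its sheet cutter `b`. -/
  gK : K
  hgK : gK ∈ O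
  /-- The sheet cutter `b`, a `V`-unit. -/
  b : Ω
  hvb : V.valuation b = 1
  /-- Further elements of `L₁°` to be made regular on the model. -/
  Z : Finset L₁
  hZ : (↑Z : Set L₁) ⊆ (O₁ : Set L₁)
  /-- THE CUT-OUT INTERFACE consumed by the charts (`DChartHensel.lean`): a fraction form of the
  sheet cutter `b` through `x` or an element of `Z` (`u b = q(z)`, `u ∈ m° ∖ 0`, `q` over `m°`),
  and the two valuative properties of `b` at every valuation ring `W` containing `x`, the
  `K`-rational cut-out function `g_K` and (the images of) `Z`, and inducing `V` on `M`: `b ∈ W`,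
  and `|b|_W = 1 ⇒ |x − a|_W ≤ |c|_W`. In the absolute case `x ∈ K` these are the conjugate-discs
  construction (`DiscCutoutPackage.lean`); in general the two-level construction through a
  henselian generator `x_K ∈ K` of `K` placed in `Z` (see the module docstring). -/
  hbfracZ : ∃ u ∈ m, u ∈ V ∧ u ≠ 0 ∧ ∃ z : L₁, (z = x ∨ z ∈ Z) ∧ ∃ q : Polynomial Ω,
    (∀ i, q.coeff i ∈ m ∧ q.coeff i ∈ V) ∧ u * b = q.eval (algebraMap L₁ Ω z)
  hbmemZ : ∀ W : ValuationSubring Ω, algebraMap L₁ Ω x ∈ W → algebraMap K Ω gK ∈ W →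
    (∀ z ∈ Z, algebraMap L₁ Ω z ∈ W) →
    (∀ z : M, ((z : algebraicClosure m Ω) : Ω) ∈ W ↔ ((z : algebraicClosure m Ω) : Ω) ∈ V) → b ∈ W
  hbcutZ : ∀ W : ValuationSubring Ω, algebraMap L₁ Ω x ∈ W → algebraMap K Ω gK ∈ W →
    (∀ z ∈ Z, algebraMap L₁ Ω z ∈ W) →
    (∀ z : M, ((z : algebraicClosure m Ω) : Ω) ∈ W ↔ ((z : algebraicClosure m Ω) : Ω) ∈ V) →
    W.valuation b = 1 → W.valuation (algebraMap L₁ Ω x - a) ≤ W.valuation c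

namespace RelCurveChart

variable {k K L₁ Ω : Type u} [Field k] [Field K] [Field L₁] [Field Ω]
  [Algebra k K] [Algebra K L₁] [Algebra k L₁] [IsScalarTower k K L₁]
  [Algebra L₁ Ω] [Algebra K Ω] [Algebra k Ω] [IsScalarTower K L₁ Ω] [IsScalarTower k L₁ Ω]
  [IsAlgClosed Ω] [FiniteDimensional K L₁] (C : RelCurveChart k K L₁ Ω)

/-- `M|m` is finite (field of the datum, as an instance). [folklore] -/
instance finM_inst : FiniteDimensional C.m C.M := C.finM

/-- `M|m` is Galois (field of the datum, as an instance). [folklore] -/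
instance galM_inst : IsGalois C.m C.M := C.galM

/-- The image of `k` in `Ω`. [folklore] -/
def kΩ : Subfield Ω := (algebraMap k Ω).fieldRange

/-- The image of `K` in `Ω`. [folklore] -/
def KΩ : Subfield Ω := (algebraMap K Ω).fieldRange

/-- The image of `L₁` in `Ω`. [folklore] -/
def L₁Ω : Subfield Ω := (algebraMap L₁ Ω).fieldRange

/-- The henselization `L = L₁^h` of `(L₁, L₁°)` inside `(Ω, V)`. [folklore] -/
def L : Subfield Ω := henselization C.V (algebraMap L₁ Ω).fieldRange

/-- The base ring `k° ↦ K`. [folklore] -/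
def R₀ : Subring K := C.Ok.toSubring.map (algebraMap k K)

/-- `x` as an element of `Ω`. [folklore] -/
def xΩ : Ω := algebraMap L₁ Ω C.x

/-- The disc coordinate `x′ = (x − a)/c`. [folklore] -/
def x' : Ω := (C.xΩ - C.a) / C.c

/-- `V` induces `K°` on `K`. [folklore] -/
theorem comap_K : C.V.comap (algebraMap K Ω) = C.O := by
  rw [IsScalarTower.algebraMap_eq K L₁ Ω, ← ValuationSubring.comap_comap, C.hV, C.hO₁]

/-- `V` induces `k°` on `k`. [folklore] -/
theorem comap_k : C.V.comap (algebraMap k Ω) = C.Ok := by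
  rw [IsScalarTower.algebraMap_eq k L₁ Ω, ← ValuationSubring.comap_comap, C.hV,
    IsScalarTower.algebraMap_eq k K L₁, ← ValuationSubring.comap_comap, C.hO₁, C.hO]

/-- `x ∈ O_V`. [folklore] -/
theorem xΩ_mem_V : C.xΩ ∈ C.V := by
  have h : C.x ∈ C.V.comap (algebraMap L₁ Ω) := by rw [C.hV]; exact C.hx
  exact h

/-- `|x′| ≤ 1`. [folklore] -/
theorem x'_mem_V : C.x' ∈ C.V := by
  rw [x', ← C.V.valuation_le_one_iff, map_div₀, div_le_one₀ ((Valuation.pos_iff _).mpr C.hc0)]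
  exact C.hΔ

/-- `y₀ ∈ m`. [folklore] -/
theorem y₀_mem_m : C.y₀ ∈ C.m := by
  rw [C.hm]
  exact IntermediateField.subset_adjoin k _ (Set.mem_singleton _)

/-- `k ≤ m`. [folklore] -/
theorem kΩ_le_m : kΩ (k := k) (Ω := Ω) ≤ C.m := by
  rintro _ ⟨c₀, rfl⟩
  rw [C.hm]
  exact (IntermediateField.adjoin k ({C.y₀} : Set Ω)).algebraMap_mem c₀

/-- `m ≤ L = L₁^h` (the constants lie in the henselization). [folklore] -/
theorem m_le_L : C.m ≤ C.L := by
  rw [C.hm]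
  intro z hz
  have hle : IntermediateField.adjoin k ({C.y₀} : Set Ω) ≤
      { (C.L).toSubring with
        algebraMap_mem' := fun c₀ => le_henselization C.V _ ⟨algebraMap k L₁ c₀, by
          rw [← IsScalarTower.algebraMap_apply]⟩
        inv_mem' := fun w hw => (C.L).inv_mem hw } :=
    IntermediateField.adjoin_le_iff.mpr (Set.singleton_subset_iff.mpr C.hy₀h)
  exact hle hz

end RelCurveChart

end Literature.AlgebraicGeometry.Resolution

end
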